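/-
Origin: expansion seat `planner-pub-hodgecm-qw8-g9-0`, handover #3 2026-08-18T13:28:45Z (md5 ad05a31971bcd4e21839591b34c606c1, 253 l.): NEW additive leaf; imports Mathlib + Qw8g9.LefPartialConjGalois => ONE rewrite `import Qw8g9.LefPartialConjGalois` -> `import HodgeCM.Model.Toy.LefPartialConjGalois`; land AFTER #1 (independent of #2); frozen copy handover/LefNormalPartner.ad05a31971bc.lean (`HOME/pub-hodgecm-qw8-g9/lean/Qw8g9/LefNormalPartner.lean`, md5 ad05a319, 253 lines);
landed by the gen-8 packager in gate run 30 as `HodgeCM/Model/Toy/LefNormalPartner.lean` (import ^import Qw8g9\.LefPartialConjGalois[ \t]*$→import HodgeCM.Model.Toy.LefPartialConjGalois ×1).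
-/
-- HANDOVER (planner-pub-hodgecm-qw8-g9-0, unit pub-hodgecm-qw8-g9): WIP module `Qw8g9.LefNormalPartner`; intended final
-- module `HodgeCM.Model.Toy.LefNormalPartner` (kind L5, separating model); NEW additive leaf; at landing rewrite
-- `import Qw8g9.LefPartialConjGalois` ↦ `import HodgeCM.Model.Toy.LefPartialConjGalois` (lands AFTER that file).
/-
Copyright (c) 2026. All rights reserved.
Released under Apache 2.0 license as described in the file LICENSE.
-/
import Mathlib
import Summits.HodgeConjecture.HodgeCM.Model.Toy.LefPartialConjGalois

/-!
# The normal-partner theorem of the mixing criterion, without `NonGenReal` (biquadratic partners)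

`LefPartialConjGalois` decides `PartialConj K₁ K₂` for a NORMAL partner `K₂` whose non-generators are totally
real (`NonGenReal K₂`: imaginary quadratic and cyclic quartic CM fields): `PartialConj K₁ K₂ ↔ ¬ galClosure K₂ ≤
galClosure K₁`. Biquadratic CM fields `K₂ = K₂⁺·k` are normal but fail `NonGenReal` (the imaginary quadratic
subfields `k, k'` consist of non-real non-generators), and they also fail `ClosureExclusive`, so neither that
criterion nor `LefClosureExclusive` covers them. This file gives the criterion for an ARBITRARY normal partner:

* `partialConj_iff_of_normal`: for `K₂` normal and one (any) embedding `b`, `PartialConj K₁ K₂` iff every element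
  of `K₂` whose `b`-value lies in `galClosure K₁` is sent by `b` to a real number;
* `partialConj_iff_nonGen_of_normal` (**normal-partner theorem**): for `K₂` normal carrying a CM type,
  `PartialConj K₁ K₂ ↔ ¬ galClosure K₂ ≤ galClosure K₁ ∧` (every NON-GENERATOR `y` of `K₂/ℚ` with `b y ∈ galClosure K₁`
  has `b y` real). For `NonGenReal K₂` the second conjunct is automatic (this recovers
  `partialConj_iff_not_le_of_normal`); for a biquadratic CM field `K₂` of degree `4` the non-generators are the
  elements of its three quadratic subfields, so the criterion reads: NEITHER IMAGINARY QUADRATIC SUBFIELD of `K₂`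
  embeds into `galClosure K₁` (the real one may: `K₁ = ℚ(ζ₅)`, `K₂ = ℚ(i, √5)` mix although `√5 ∈ ℚ(ζ₅)`).
* `partialConj_iff_of_not_nonGenReal`, `partialConj_iff_of_biquadratic` (**biquadratic partner**): for `K₂` normal
  WITH a non-real non-generator the embedding conjunct is implied by the other one and no CM type is needed —
  `PartialConj K₁ K₂` iff every non-generator (degree `4`: every element of degree `≤ 2`) of `K₂` visible inside
  `galClosure K₁` is real there (normality moves a bad value of any embedding to a bad value of `b`:
  `exists_liftK_eq_of_normal`, `adjoin_ne_top_iff_of_minpoly_eq`).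
* `lefModel` headlines `lef_hc_prod_of_presented_of_normalPartner`, `lef_hc_cmObj_prod_cmObj_of_normalPartner`,
  `lef_hc_prod_of_presented_of_biquadratic`, `lef_hc_cmObj_prod_cmObj_of_biquadratic`.

Together with `LefClosureExclusive` (both fields non-biquadratic) this decides `PartialConj K₁ K₂` — and with it
(`LefPartialConj`) HC in `lefModel` for all products of presented CM objects — for every pair of CM fields of
degree `≤ 4` from the subfield data of the two Galois closures.

References: Mathlib only, on top of `LefPartialConjGalois`. Nothing is posited; no cited fact; no data.
-/

noncomputable section

set_option backward.isDefEq.respectTransparency false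

namespace HodgeCM.Toy

open Literature.AlgebraicGeometry.Motives (CMType)

section NormalPartner

variable {K₁ K₂ : Type} [Field K₁] [NumberField K₁] [Field K₂] [NumberField K₂]

/-- for a NORMAL partner `K₂` (so that one embedding `b` fills its Galois closure): `PartialConj K₁ K₂` iff every
element of `K₂` whose `b`-value lies in the Galois closure of `K₁` has a real `b`-value -/
theorem partialConj_iff_of_normal [Normal ℚ K₂] (b : K₂ →+* ℂ) :
    PartialConj K₁ K₂ ↔ ∀ y : K₂, liftK b y ∈ galClosure K₁ → starRingEnd ℂ (b y) = b y := by
  rw [partialConj_iff_conj_eq, galClosure_eq_fieldRange K₂ b]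
  constructor
  · intro h y hy
    exact h (liftK b y) hy ⟨y, rfl⟩
  · rintro h x hx₁ ⟨y, rfl⟩
    exact h y hx₁

/-- sufficiency half of the normal-partner theorem (no CM type needed): if `K₂` (normal) does not embed into the
Galois closure `L₁` of `K₁` and every non-generator of `K₂` visible inside `L₁` is real there, then
`PartialConj K₁ K₂` — a generator `y` visible inside `L₁` would put `b(K₂) = ℚ(b y)` inside `L₁`. -/
theorem partialConj_of_normalPartner [Normal ℚ K₂] (b : K₂ →+* ℂ) (hle : ¬ galClosure K₂ ≤ galClosure K₁)
    (hreal : ∀ y : K₂, IntermediateField.adjoin ℚ {y} ≠ ⊤ → liftK b y ∈ galClosure K₁ →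
      starRingEnd ℂ (b y) = b y) : PartialConj K₁ K₂ := by
  rw [partialConj_iff_of_normal b]
  intro y hy
  by_cases hgen : IntermediateField.adjoin ℚ {y} = ⊤
  · refine absurd ?_ hle
    rw [galClosure_eq_fieldRange K₂ b, fieldRange_liftA_eq_adjoin K₂ b y hgen,
      IntermediateField.adjoin_simple_le_iff]
    exact hy
  · exact hreal y hgen hy

/-- **Normal-partner theorem.** For `K₂` normal over `ℚ` carrying a CM type and any number field `K₁`:
`PartialConj K₁ K₂` iff `K₂` does not embed into the Galois closure `L₁` of `K₁` AND every non-generator `y` of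
`K₂/ℚ` with `b y ∈ L₁` has `b y` real. (For a biquadratic CM field of degree `4`: iff neither imaginary quadratic
subfield of `K₂` embeds into `L₁`.) -/
theorem partialConj_iff_nonGen_of_normal [Normal ℚ K₂] (Ψ : CMType K₂) (b : K₂ →+* ℂ) :
    PartialConj K₁ K₂ ↔ ¬ galClosure K₂ ≤ galClosure K₁ ∧
      ∀ y : K₂, IntermediateField.adjoin ℚ {y} ≠ ⊤ → liftK b y ∈ galClosure K₁ →
        starRingEnd ℂ (b y) = b y :=
  ⟨fun hc => ⟨fun hle => not_partialConj_of_galClosure_le hle Ψ hc,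
    fun y _ hy => (partialConj_iff_of_normal b).mp hc y hy⟩,
   fun h => partialConj_of_normalPartner b h.1 h.2⟩

/-- the `NonGenReal` criterion of `LefPartialConjGalois` is the special case in which the second conjunct is
automatic -/
theorem partialConj_iff_not_le_of_normal' [Normal ℚ K₂] (hK₂ : NonGenReal K₂) (Ψ : CMType K₂) :
    PartialConj K₁ K₂ ↔ ¬ galClosure K₂ ≤ galClosure K₁ := by
  obtain ⟨b⟩ := (inferInstance : Nonempty (K₂ →+* ℂ))
  rw [partialConj_iff_nonGen_of_normal Ψ b]
  exact ⟨fun h => h.1, fun h => ⟨h, fun y hy _ => hK₂ y hy b⟩⟩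

/-- for NORMAL `K₂` every value of every embedding is a value of the fixed embedding `b` at an element with the
same minimal polynomial -/
theorem exists_liftK_eq_of_normal [Normal ℚ K₂] (b b₀ : K₂ →+* ℂ) (y₀ : K₂) :
    ∃ y₁ : K₂, liftK b y₁ = liftK b₀ y₀ ∧ minpoly ℚ y₁ = minpoly ℚ y₀ := by
  have hmem : liftK b₀ y₀ ∈ (liftA K₂ b).fieldRange := by
    rw [← galClosure_eq_fieldRange K₂ b]
    exact liftK_mem_galClosure K₂ b₀ y₀
  obtain ⟨y₁, hy₁⟩ := hmem
  refine ⟨y₁, hy₁, ?_⟩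
  rw [← minpoly.algHom_eq (liftA K₂ b) (liftA K₂ b).injective y₁,
    ← minpoly.algHom_eq (liftA K₂ b₀) (liftA K₂ b₀).injective y₀]
  exact congrArg _ hy₁

/-- … in particular generators go to generators and non-generators to non-generators -/
theorem adjoin_ne_top_iff_of_minpoly_eq {y₁ y₀ : K₂} (h : minpoly ℚ y₁ = minpoly ℚ y₀) :
    IntermediateField.adjoin ℚ {y₁} ≠ ⊤ ↔ IntermediateField.adjoin ℚ {y₀} ≠ ⊤ := by
  have hd : Module.finrank ℚ ↥(IntermediateField.adjoin ℚ {y₁})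
      = Module.finrank ℚ ↥(IntermediateField.adjoin ℚ {y₀}) := by
    rw [IntermediateField.adjoin.finrank (Algebra.IsIntegral.isIntegral y₁),
      IntermediateField.adjoin.finrank (Algebra.IsIntegral.isIntegral y₀), h]
  have key : ∀ {u v : K₂}, Module.finrank ℚ ↥(IntermediateField.adjoin ℚ {u})
      = Module.finrank ℚ ↥(IntermediateField.adjoin ℚ {v}) →
      IntermediateField.adjoin ℚ {u} = ⊤ → IntermediateField.adjoin ℚ {v} = ⊤ := by
    intro u v huv hu
    refine IntermediateField.eq_of_le_of_finrank_eq le_top ?_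
    rw [← huv, hu]
  exact not_congr ⟨key hd, key hd.symm⟩

/-- **Biquadratic-type partner.** For `K₂` normal with a NON-REAL NON-GENERATOR (`¬ NonGenReal K₂`: biquadratic CM
fields, cyclic sextic CM fields, …) the embedding conjunct of the normal-partner theorem is implied by the other
one, and no CM type is needed: `PartialConj K₁ K₂` iff every non-generator of `K₂` visible inside `galClosure K₁`
(through `b`) is real there. -/
theorem partialConj_iff_of_not_nonGenReal [Normal ℚ K₂] (hng : ¬ NonGenReal K₂) (b : K₂ →+* ℂ) :
    PartialConj K₁ K₂ ↔ ∀ y : K₂, IntermediateField.adjoin ℚ {y} ≠ ⊤ → liftK b y ∈ galClosure K₁ →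
      starRingEnd ℂ (b y) = b y := by
  refine ⟨fun hc y _ hy => (partialConj_iff_of_normal b).mp hc y hy, fun h => ?_⟩
  refine partialConj_of_normalPartner b (fun hle => hng ?_) h
  intro y₀ hy₀ b₀
  obtain ⟨y₁, hy₁, hmin⟩ := exists_liftK_eq_of_normal b b₀ y₀
  have hgen : IntermediateField.adjoin ℚ {y₁} ≠ ⊤ := (adjoin_ne_top_iff_of_minpoly_eq hmin).mpr hy₀
  have hmem : liftK b y₁ ∈ galClosure K₁ := hle (liftK_mem_galClosure K₂ b y₁)
  have hreal := h y₁ hgen hmem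
  have hval : (b y₁ : ℂ) = b₀ y₀ := by
    have := congrArg (fun z : Qbar => (z : ℂ)) hy₁
    simpa [coe_liftK] using this
  rwa [hval] at hreal

/-- in a field of degree `4` a non-generator has degree `≤ 2` over `ℚ`: the non-generator condition only
concerns the quadratic subfields -/
theorem finrank_adjoin_le_two_of_ne_top (hK : Module.finrank ℚ K₂ = 4) (y : K₂)
    (hy : IntermediateField.adjoin ℚ {y} ≠ ⊤) :
    Module.finrank ℚ ↥(IntermediateField.adjoin ℚ {y}) ≤ 2 := by
  have hd : Module.finrank ℚ ↥(IntermediateField.adjoin ℚ {y}) ∣ 4 := by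
    rw [← hK, ← IntermediateField.finrank_top' (F := ℚ) (E := K₂)]
    exact IntermediateField.finrank_dvd_of_le_right le_top
  have hne : Module.finrank ℚ ↥(IntermediateField.adjoin ℚ {y}) ≠ 4 := fun h =>
    hy (IntermediateField.eq_of_le_of_finrank_eq le_top
      (h.trans ((IntermediateField.finrank_top' (F := ℚ) (E := K₂)).trans hK).symm))
  have h4 : Module.finrank ℚ ↥(IntermediateField.adjoin ℚ {y}) ≤ 4 := Nat.le_of_dvd (by norm_num) hd
  interval_cases (Module.finrank ℚ ↥(IntermediateField.adjoin ℚ {y})) <;> simp_all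

/-- **Quartic normal partner**: for `K₂` normal of degree `4` carrying a CM type, `PartialConj K₁ K₂` iff `K₂` does
not embed into `L₁ = galClosure K₁` and every `y ∈ K₂` of degree `≤ 2` over `ℚ` with `b y ∈ L₁` has `b y` real
(cyclic `K₂`: automatic, the quadratic subfield is real; biquadratic `K₂ = K₂⁺k`: neither `k` nor `k'` embeds into
`L₁`). -/
theorem partialConj_iff_of_normal_of_finrank_eq_four [Normal ℚ K₂] (hK : Module.finrank ℚ K₂ = 4)
    (Ψ : CMType K₂) (b : K₂ →+* ℂ) :
    PartialConj K₁ K₂ ↔ ¬ galClosure K₂ ≤ galClosure K₁ ∧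
      ∀ y : K₂, Module.finrank ℚ ↥(IntermediateField.adjoin ℚ {y}) ≤ 2 → liftK b y ∈ galClosure K₁ →
        starRingEnd ℂ (b y) = b y := by
  rw [partialConj_iff_nonGen_of_normal Ψ b]
  refine ⟨fun h => ⟨h.1, fun y hy hmem => ?_⟩,
    fun h => ⟨h.1, fun y hy hmem => h.2 y (finrank_adjoin_le_two_of_ne_top hK y hy) hmem⟩⟩
  by_cases hgen : IntermediateField.adjoin ℚ {y} = ⊤
  · exfalso
    have h4 : Module.finrank ℚ ↥(IntermediateField.adjoin ℚ {y}) = 4 := by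
      rw [hgen, IntermediateField.finrank_top', hK]
    omega
  · exact h.2 y hgen hmem

/-- **Biquadratic partner** (`K₂` normal of degree `4` with a non-real non-generator, i.e. a biquadratic CM field
`K₂ = K₂⁺k`): `PartialConj K₁ K₂` iff every `y ∈ K₂` of degree `≤ 2` over `ℚ` whose `b`-value lies in
`galClosure K₁` has a real `b`-value — neither imaginary quadratic subfield `k, k'` of `K₂` embeds into
`galClosure K₁`. No CM type, no condition on `K₁`. -/
theorem partialConj_iff_of_biquadratic [Normal ℚ K₂] (hK : Module.finrank ℚ K₂ = 4) (hng : ¬ NonGenReal K₂)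
    (b : K₂ →+* ℂ) :
    PartialConj K₁ K₂ ↔ ∀ y : K₂, Module.finrank ℚ ↥(IntermediateField.adjoin ℚ {y}) ≤ 2 →
      liftK b y ∈ galClosure K₁ → starRingEnd ℂ (b y) = b y := by
  rw [partialConj_iff_of_not_nonGenReal hng b]
  refine ⟨fun h y hy hmem => ?_, fun h y hy hmem => h y (finrank_adjoin_le_two_of_ne_top hK y hy) hmem⟩
  by_cases hgen : IntermediateField.adjoin ℚ {y} = ⊤
  · exfalso
    have h4 : Module.finrank ℚ ↥(IntermediateField.adjoin ℚ {y}) = 4 := by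
      rw [hgen, IntermediateField.finrank_top', hK]
    omega
  · exact h y hgen hmem

end NormalPartner

section Headline

variable (K₁ K₂ : CMField)

/-- **HEADLINE (normal partner, unconditional form).** `K₂` a NORMAL CM field of degree `≤ 4` (imaginary quadratic,
cyclic quartic or biquadratic) that does not embed into the Galois closure `L₁` of the CM field `K₁` of degree
`≤ 4`, and whose non-generators visible inside `L₁` are real there: every product of CM abelian varieties presented
over `K₁` with ones presented over `K₂` satisfies HC in `lefModel`. -/
theorem lef_hc_prod_of_presented_of_normalPartner [Normal ℚ K₂] (b : K₂ →+* ℂ)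
    (hle : ¬ galClosure K₂ ≤ galClosure K₁)
    (hreal : ∀ y : K₂, IntermediateField.adjoin ℚ {y} ≠ ⊤ → liftK b y ∈ galClosure K₁ →
      starRingEnd ℂ (b y) = b y)
    (h₁ : Module.finrank ℚ K₁ ≤ 4) (h₂ : Module.finrank ℚ K₂ ≤ 4) {X Y : Obj} (hX : X.Presented K₁)
    (hY : Y.Presented K₂) : lefModel.HC (X.prod Y) :=
  lef_hc_prod_of_presented_of_presented K₁ K₂ h₁ h₂ (partialConj_of_normalPartner b hle hreal) hX hY

/-- e.g. `A_{(K₁,Φ)} × A_{(K₂,Φ')}` -/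
theorem lef_hc_cmObj_prod_cmObj_of_normalPartner [Normal ℚ K₂] (b : K₂ →+* ℂ)
    (hle : ¬ galClosure K₂ ≤ galClosure K₁)
    (hreal : ∀ y : K₂, IntermediateField.adjoin ℚ {y} ≠ ⊤ → liftK b y ∈ galClosure K₁ →
      starRingEnd ℂ (b y) = b y)
    (h₁ : Module.finrank ℚ K₁ ≤ 4) (h₂ : Module.finrank ℚ K₂ ≤ 4) (Φ : CMType K₁) (Φ' : CMType K₂) :
    lefModel.HC ((cmObj K₁ Φ).prod (cmObj K₂ Φ')) :=
  lef_hc_cmObj_prod_cmObj K₁ K₂ h₁ h₂ (partialConj_of_normalPartner b hle hreal) Φ Φ'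

/-- **HEADLINE (biquadratic partner).** `K₂` a normal CM field of degree `≤ 4` with a non-real non-generator (a
biquadratic CM field) none of whose non-generators takes a non-real value inside the Galois closure of the CM
field `K₁` of degree `≤ 4` (neither imaginary quadratic subfield of `K₂` embeds into `galClosure K₁`): every
product of CM abelian varieties presented over `K₁` with ones presented over `K₂` satisfies HC in `lefModel`.
No CM type and no embedding condition on `K₂` itself are needed. -/
theorem lef_hc_prod_of_presented_of_biquadratic [Normal ℚ K₂] (hng : ¬ NonGenReal K₂) (b : K₂ →+* ℂ)
    (hreal : ∀ y : K₂, IntermediateField.adjoin ℚ {y} ≠ ⊤ → liftK b y ∈ galClosure K₁ →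
      starRingEnd ℂ (b y) = b y)
    (h₁ : Module.finrank ℚ K₁ ≤ 4) (h₂ : Module.finrank ℚ K₂ ≤ 4) {X Y : Obj} (hX : X.Presented K₁)
    (hY : Y.Presented K₂) : lefModel.HC (X.prod Y) :=
  lef_hc_prod_of_presented_of_presented K₁ K₂ h₁ h₂ ((partialConj_iff_of_not_nonGenReal hng b).mpr hreal) hX hY

/-- e.g. `A_{(K₁,Φ)} × A_{(K₂,Φ')}` with `K₂` biquadratic -/
theorem lef_hc_cmObj_prod_cmObj_of_biquadratic [Normal ℚ K₂] (hng : ¬ NonGenReal K₂) (b : K₂ →+* ℂ)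
    (hreal : ∀ y : K₂, IntermediateField.adjoin ℚ {y} ≠ ⊤ → liftK b y ∈ galClosure K₁ →
      starRingEnd ℂ (b y) = b y)
    (h₁ : Module.finrank ℚ K₁ ≤ 4) (h₂ : Module.finrank ℚ K₂ ≤ 4) (Φ : CMType K₁) (Φ' : CMType K₂) :
    lefModel.HC ((cmObj K₁ Φ).prod (cmObj K₂ Φ')) :=
  lef_hc_cmObj_prod_cmObj K₁ K₂ h₁ h₂ ((partialConj_iff_of_not_nonGenReal hng b).mpr hreal) Φ Φ'

/-- the NEGATIVE reading: a normal CM partner one of whose non-generators takes a non-real value inside the Galois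
closure of `K₁` (e.g. a biquadratic `K₂ ⊇ k` with `k ↪ galClosure K₁`) has no partial conjugation with `K₁` -/
theorem not_partialConj_of_nonGen (b : K₂ →+* ℂ) (y : K₂) (hmem : liftK b y ∈ galClosure K₁)
    (hy : starRingEnd ℂ (b y) ≠ b y) : ¬ PartialConj K₁ K₂ :=
  not_partialConj_of_mem_galClosure b y hmem hy

end Headline

end HodgeCM.Toy
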